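import Mathlib
import Summits.ValiantsHypothesis.ValiantsHypothesis.Theorems.GrenetZeonTwoDimCoefficientsScalingShadowFamily
import Summits.ValiantsHypothesis.ValiantsHypothesis.Theorems.GrenetZeonTwoDimCoefficientsScalingIndexShadowDet

/-!
# Crux `GrenetZeon.TwoDimCoefficients` (stmt-ValiantsHypothesis-8062), stub `stub_dualUnipotent`:
# scaling-closure — SINGLE-CHANNEL index-`n` pencils obey Mignon–Ressayre (`n² ≤ 2m`)

By ✓ `topCompanion_eq` the companions of a unipotent dual representation with numerator of degree `≤ n` are
`[D_k]_{kn} = c·[X^k] det(1 + X·c⁻¹P^top)`.  If the top numerator `P^top` (degree-`n` part of `adj A·B`; for an index-`n`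
normal form `A = A₀(1 − N)`, `Nⁿ = 0`: `P^top = c·(−N)^{n−1}A₀⁻¹B₁`) has RANK ONE, `P^top = u ⊗ v`, then
`det(1 + X·c⁻¹ u ⊗ v) = 1 + X·c⁻¹(v·u)` has no coefficients beyond `X¹`: the representation is COMPANION-FREE and
✓ `sq_le_two_mul_of_companionFree` gives `n² ≤ 2m`:

* `charpolyRev_vecMulVec` — `det(1 − X·(u ⊗ v)) = 1 − X·(v·u)` (matrix determinant lemma);
* ★ `sq_le_two_mul_of_rankOneTop` — `det A = c ≠ 0`, `per_n = α·c + β·tr(adj A·B)`, `deg adj A ≤ n − 1`,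
  `[adj A·B]^top = u ⊗ v` ⟹ `n² ≤ 2m` (`n ≥ 3`, `m ≥ 2`).

The class covers every index-`n` pencil whose top power `N^{n−1}` has rank one (exactly one maximal chain, arbitrary —
wild — lower chains), and every closed single-source/single-sink trace program of exact depth; it is the first MR-strength
rung for a class of WILD pencils.  (The 16th hand's `ε`-linear case is `B` of rank one; here only the TOP of the
numerator is constrained.)

HONEST FRAMING: a rung on a sub-class; the stub `DualUnipotentBound`, the crux and `VP ≠ VNP` remain open.

References: T. Mignon, N. Ressayre, Int. Math. Res. Not. 2004:79, Thm. 1.1 (via the tree); folklore (matrix determinant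
lemma).
-/

-- single-conjunct layout `Summits/ValiantsHypothesis/ValiantsHypothesis`: the duplicated namespace
-- component is mandated by the tree.
set_option linter.dupNamespace false
set_option autoImplicit false

noncomputable section

namespace Summit.ValiantsHypothesis.ValiantsHypothesis.Theorems.GrenetZeonTwoDimCoefficients.ScalingClosure

open MvPolynomial Matrix
open Literature.Computability.AlgebraicComplexity
open Summit.ValiantsHypothesis.ValiantsHypothesis.Cruxes.TwoDimCoefficients.DimTwoCases

section RankOne

variable {R : Type*} [CommRing R] {ι : Type*} [Fintype ι] [DecidableEq ι]

/-- **`det(1 − X·(u ⊗ v)) = 1 − X·(v·u)`** (matrix determinant lemma for a rank-one matrix). [folklore] -/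
theorem charpolyRev_vecMulVec (u v : ι → R) :
    (vecMulVec u v).charpolyRev = 1 - Polynomial.X * Polynomial.C (v ⬝ᵥ u) := by
  have hmap : (Polynomial.X : Polynomial R) • (vecMulVec u v).map Polynomial.C =
      -(vecMulVec (fun i => -(Polynomial.X * Polynomial.C (u i))) (fun j => Polynomial.C (v j))) := by
    ext i j
    simp only [Matrix.smul_apply, Matrix.map_apply, vecMulVec_apply, Matrix.neg_apply, smul_eq_mul, map_mul]
    ring
  rw [Matrix.charpolyRev, hmap, sub_neg_eq_add, Matrix.vecMulVec_eq Unit, det_one_add_replicateCol_mul_replicateRow,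
    dotProduct, dotProduct, map_sum, Finset.mul_sum, sub_eq_add_neg, ← Finset.sum_neg_distrib]
  refine congrArg _ (Finset.sum_congr rfl fun i _ => ?_)
  rw [map_mul]
  ring

/-- Hence `[X^k] det(1 − X·(u ⊗ v)) = 0` for `k ≥ 2`. [folklore] -/
theorem coeff_charpolyRev_vecMulVec_eq_zero (u v : ι → R) {k : ℕ} (hk : 2 ≤ k) :
    ((vecMulVec u v).charpolyRev).coeff k = 0 := by
  obtain ⟨l, rfl⟩ : ∃ l, k = l + 1 + 1 := ⟨k - 2, by omega⟩
  rw [charpolyRev_vecMulVec, Polynomial.coeff_sub, Polynomial.coeff_one, if_neg (by omega), Polynomial.coeff_X_mul,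
    Polynomial.coeff_C, if_neg (by omega), sub_zero]

end RankOne

section Rung

/-- ★ **Single-channel index-`n` pencils obey Mignon–Ressayre.**  Let `per_n = α·c + β·tr(adj A·B)` be a unipotent
dual representation (`det A = c ≠ 0`, `A, B` affine `m × m`, `n = k + 3`, `m ≥ 2`) with `deg adj A ≤ n − 1` (e.g. an
index-`n` normal form, ✓ `totalDegree_adjugate_le_of_index`) whose top numerator is of rank one:
`[adj A·B]_n = u ⊗ v` entrywise.  Then `n² ≤ 2m`. [cite: MignonRessayre2004, Thm. 1.1 — via the tree; folklore] -/
theorem sq_le_two_mul_of_rankOneTop {k m : ℕ} (A B : AffMat (k + 3) m) (hA : IsAffine A) (hB : IsAffine B)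
    (α β c : ℂ) (hc : c ≠ 0) (hβ : β ≠ 0) (hdet : A.det = MvPolynomial.C c)
    (hper : perPoly (Fin (k + 3)) ℂ =
      MvPolynomial.C α * A.det + MvPolynomial.C β * (A.adjugate * B).trace)
    (hm2 : 2 ≤ m) (hadj : ∀ i j, (A.adjugate i j).totalDegree ≤ k + 3 - 1)
    (u v : Fin m → MvPolynomial (Fin (k + 3) × Fin (k + 3)) ℂ)
    (htop : ∀ i j, homogeneousComponent (k + 3) ((A.adjugate * B) i j) = u i * v j) :
    (k + 3) ^ 2 ≤ 2 * m := by
  classical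
  have hP : ∀ i j, ((A.adjugate * B) i j).totalDegree ≤ k + 3 := fun i j =>
    (totalDegree_adjugate_mul_le A B (k + 3 - 1) hadj hB i j).trans (by omega)
  refine sq_le_two_mul_of_companionFree A B hA hB α β c hc hβ hdet hper hm2 (fun j =>
    (det ((Polynomial.X : Polynomial (MvPolynomial (Fin (k + 3) × Fin (k + 3)) ℂ)) •
      B.map Polynomial.C + A.map Polynomial.C)).coeff j) (fun j => rfl) ?_
  intro j hj d hd
  rcases hd.eq_or_lt with h | h
  · rw [← h, topCompanion_eq A B c hc hdet hP (vecMulVec u v) (fun i j => by rw [vecMulVec_apply, htop]) j,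
      show -((MvPolynomial.C c⁻¹ : MvPolynomial (Fin (k + 3) × Fin (k + 3)) ℂ) • vecMulVec u v) =
        vecMulVec (-((MvPolynomial.C c⁻¹ : MvPolynomial (Fin (k + 3) × Fin (k + 3)) ℂ) • u)) v from
          Matrix.ext fun i j => by
            simp only [Matrix.neg_apply, Matrix.smul_apply, vecMulVec_apply, Pi.neg_apply, Pi.smul_apply,
              smul_eq_mul]
            ring,
      coeff_charpolyRev_vecMulVec_eq_zero _ _ hj, mul_zero]
  · exact homogeneousComponent_eq_zero _ _
      ((totalDegree_coeff_det_le_of_adjugate (by omega) A B hB c hc hdet hadj j).trans_lt h)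

end Rung

end Summit.ValiantsHypothesis.ValiantsHypothesis.Theorems.GrenetZeonTwoDimCoefficients.ScalingClosure

end
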